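import Mathlib
import Literature.Computability.AlgebraicComplexity.LocalStrongUSP
import Summits.MatrixMultiplication.MatrixMultiplication.Theorems.RectangularThmB.Negative.SkewUSPFamilies

/-!
# Line `localCapacity` of crux `SemilatticeSTPP.Thesis` (stmt-MatrixMultiplication-5969):
# the USP read-back — every local strong USP is a capacity design over `ℤ/ℓ`, and a design at `ε = 19/22 < 1`

The registered stub `stub_capacityDesign` of `Cruxes/Thesis/Lines/localCapacity.lean` asks, for every `ε > 0`, for a
finite commutative base `C` (every element regular), TPP letters, and a LOCALLY KILLED word family whose value beats
`|C|^n` at exponent `(2+ε)/3`.  The line card claims this is "literally" true for `ε ≳ 0.48` by the (local) strong USPs of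
Cohn–Kleinberg–Szegedy–Umans 2005 (Prop. 18 / Prop. 34 / Thm. 33).  This file makes the dictionary formal:

* `capacityBodyAt_of_isLocalStrongUSP` — for every `ℓ ≥ 2`, every local strong USP `row : Fin L → Fin k → Fin 3` (tree
  `Literature.Computability.AlgebraicComplexity.IsLocalStrongUSP`, CKSU §6.1) and every exponent `τ` with
  `ℓ^k < L·((ℓ−1)^k)^τ`, the ∃-body of the stub holds at exponent `τ`: base `C := Multiplicative (ZMod ℓ)`, three letters
  (code `0` ↦ `⟨1,1,ℓ−1⟩` "C-role": `α = 1`, `β(u) = u+1`, `γ(u') = u'+1`; code `1` ↦ `⟨ℓ−1,1,1⟩` "A-role": `α(s) = −(s+1)`,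
  `β = 1`, `γ(s') = −(s'+1)`; code `2` ↦ `⟨1,ℓ−1,1⟩` "B-role": `α(t) = t+1`, `β(t') = −(t'+1)`, `γ = 1`, additively in `ℤ/ℓ`,
  the nonzero residues being `1,…,ℓ−1`), words := the USP rows.  The six local-strong-USP patterns of CKSU are EXACTLY the
  semantic kills of these three letters ("exactly one nonzero term"): at a pattern coordinate the relation `α·β = γ` reads
  `x = 0` for a nonzero residue `x`.  Each word has value `(ℓ−1)^k`.  With `stub_localDesignSound` (landed,
  `Theorems/SemilatticeSTPPThesisStubLocalDesignSound.lean`) this re-derives CKSU Thm. 33 (USP ⇒ STPP family in `Cyc_ℓ^k`)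
  inside the monoid-TPP language.
* `capacityBodyAt_cyc11` — the instance: the tree's width-11 local strong USP `cyc11` (11 cyclic shifts of `21113133133`,
  `Theorems/RectangularThmB/Negative/SkewUSPFamilies.lean`) over `ℤ/17` beats at exponent `21/22 = (2 + 19/22)/3`:
  `17^11 < 11·(16^11)^{21/22} = 11·2^42`.  So the stub's ∃-body holds at `ε = 19/22 < 1` with `L = 11` words and genuine
  kills (`capacityDesignBody_at_nineteen_22nds`) — below `ε = 1`, where no single block can do it in a commutative host.

Mathlib + the two tree files above; sorry-free; no new definitions (all design data are existential witnesses).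
-/

set_option linter.dupNamespace false
-- (single-conjunct summit: the namespace repeats `MatrixMultiplication`)

namespace Summit.MatrixMultiplication.MatrixMultiplication.Theorems.SemilatticeSTPPThesis

open Literature.Computability.AlgebraicComplexity
open Summit.MatrixMultiplication.MatrixMultiplication.Theorems.RectangularThmB.Negative (cyc11 cyc11_isLocalStrongUSP)

/-- **USP read-back.**  Every local strong USP (CKSU 2005 §6.1) of `L` rows and width `k` is a capacity design in the
sense of `stub_capacityDesign` over the base `ℤ/ℓ` (written multiplicatively), at every exponent `τ` with
`ℓ^k < L·((ℓ−1)^k)^τ`: letters `⟨1,1,ℓ−1⟩, ⟨ℓ−1,1,1⟩, ⟨1,ℓ−1,1⟩` for the symbols `1,2,3` (coded `0,1,2`), words = rows,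
the USP patterns being exactly the semantic kills.  [cite: CohnKleinbergSzegedyUmans2005, Thm. 33 (p. 10)] -/
theorem capacityBodyAt_of_isLocalStrongUSP :
    ∀ (ℓ : ℕ), 2 ≤ ℓ → ∀ (k L : ℕ) (row : Fin L → Fin k → Fin 3),
      Literature.Computability.AlgebraicComplexity.IsLocalStrongUSP row →
      ∀ τ : ℝ, (ℓ : ℝ) ^ k < L * (((ℓ - 1) ^ k : ℕ) : ℝ) ^ τ →
      ∃ (C : Type) (_ : CommMonoid C) (_ : Fintype C),
      (∀ x : C, ∃ y : C, x * y * x = x) ∧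
      ∃ (k : ℕ) (ag bg cg : Fin k → ℕ)
        (αg : (Σ σ : Fin k, Fin (ag σ) × Fin (bg σ)) → C)
        (βg : (Σ σ : Fin k, Fin (bg σ) × Fin (cg σ)) → C)
        (γg : (Σ σ : Fin k, Fin (ag σ) × Fin (cg σ)) → C)
        (L n : ℕ) (row : Fin L → Fin n → Fin k),
        (∀ (σ : Fin k) (s s' : Fin (ag σ)) (t t' : Fin (bg σ)) (u u' : Fin (cg σ)),
            αg ⟨σ, (s, t)⟩ * βg ⟨σ, (t', u)⟩ = γg ⟨σ, (s', u')⟩ ↔ (s' = s ∧ t = t' ∧ u' = u)) ∧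
        (∀ i j l : Fin L, (i ≠ j ∨ j ≠ l) → ∃ c : Fin n,
            ∀ (s : Fin (ag (row i c))) (t : Fin (bg (row i c))) (t' : Fin (bg (row j c)))
              (u : Fin (cg (row j c))) (s' : Fin (ag (row l c))) (u' : Fin (cg (row l c))),
              αg ⟨row i c, (s, t)⟩ * βg ⟨row j c, (t', u)⟩ ≠ γg ⟨row l c, (s', u')⟩) ∧
        (Fintype.card C : ℝ) ^ n <
          ∑ i : Fin L, (((∏ c, ag (row i c)) * (∏ c, bg (row i c)) * (∏ c, cg (row i c)) : ℕ) : ℝ) ^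
            τ := by
  intro ℓ hℓ k L row hU τ hval
  haveI : NeZero ℓ := ⟨by omega⟩
  -- the nonzero residues `x + 1`, `x < ℓ - 1`
  have hnz : ∀ x : ℕ, x < ℓ - 1 → ((x + 1 : ℕ) : ZMod ℓ) ≠ 0 := by
    intro x hx h
    rw [ZMod.natCast_eq_zero_iff] at h
    exact absurd (Nat.le_of_dvd (by omega) h) (by omega)
  have hinj : ∀ x y : ℕ, x < ℓ - 1 → y < ℓ - 1 →
      ((x + 1 : ℕ) : ZMod ℓ) = ((y + 1 : ℕ) : ZMod ℓ) → x = y := by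
    intro x y hx hy h
    have h' := congrArg ZMod.val h
    rw [ZMod.val_natCast_of_lt (by omega), ZMod.val_natCast_of_lt (by omega)] at h'
    omega
  -- shapes and letters (codes: 0 = C-role ⟨1,1,ℓ-1⟩, 1 = A-role ⟨ℓ-1,1,1⟩, 2 = B-role ⟨1,ℓ-1,1⟩)
  refine ⟨Multiplicative (ZMod ℓ), inferInstance, inferInstance, fun x => ⟨x⁻¹, by group⟩, 3,
    fun σ => if σ = 1 then ℓ - 1 else 1, fun σ => if σ = 2 then ℓ - 1 else 1, fun σ => if σ = 0 then ℓ - 1 else 1,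
    fun x => if x.1 = 1 then Multiplicative.ofAdd (-(((x.2.1.val + 1 : ℕ) : ZMod ℓ)))
      else if x.1 = 2 then Multiplicative.ofAdd (((x.2.2.val + 1 : ℕ) : ZMod ℓ)) else 1,
    fun y => if y.1 = 0 then Multiplicative.ofAdd (((y.2.2.val + 1 : ℕ) : ZMod ℓ))
      else if y.1 = 2 then Multiplicative.ofAdd (-(((y.2.1.val + 1 : ℕ) : ZMod ℓ))) else 1,
    fun z => if z.1 = 0 then Multiplicative.ofAdd (((z.2.2.val + 1 : ℕ) : ZMod ℓ))
      else if z.1 = 1 then Multiplicative.ofAdd (-(((z.2.1.val + 1 : ℕ) : ZMod ℓ))) else 1,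
    L, k, row, ?_, ?_, ?_⟩
  · -- same-letter iff, letter by letter
    intro σ s s' t t' u u'
    have hs := s.isLt; have hs' := s'.isLt; have ht := t.isLt; have ht' := t'.isLt
    have hu := u.isLt; have hu' := u'.isLt
    fin_cases σ
    · -- code 0: ⟨1,1,ℓ-1⟩, α = 1, β(u) = u+1, γ(u') = u'+1
      simp only [Fin.zero_eta, Fin.isValue, zero_ne_one, ↓reduceIte, Fin.reduceEq, one_mul] at hs hs' ht ht' hu hu' ⊢
      constructor
      · intro h
        have h1 : ((u.val + 1 : ℕ) : ZMod ℓ) = ((u'.val + 1 : ℕ) : ZMod ℓ) := Multiplicative.ofAdd.injective h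
        refine ⟨Fin.ext (by omega), Fin.ext (by omega), Fin.ext ?_⟩
        exact (hinj _ _ hu hu' h1).symm
      · rintro ⟨-, -, rfl⟩; rfl
    · -- code 1: ⟨ℓ-1,1,1⟩, α(s) = -(s+1), β = 1, γ(s') = -(s'+1)
      simp only [Fin.mk_one, Fin.isValue, ↓reduceIte, one_ne_zero, Fin.reduceEq, mul_one] at hs hs' ht ht' hu hu' ⊢
      constructor
      · intro h
        have h1 : -((s.val + 1 : ℕ) : ZMod ℓ) = -((s'.val + 1 : ℕ) : ZMod ℓ) := Multiplicative.ofAdd.injective h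
        refine ⟨Fin.ext ?_, Fin.ext (by omega), Fin.ext (by omega)⟩
        exact (hinj _ _ hs hs' (neg_injective h1)).symm
      · rintro ⟨rfl, -, -⟩; rfl
    · -- code 2: ⟨1,ℓ-1,1⟩, α(t) = t+1, β(t') = -(t'+1), γ = 1
      simp only [Fin.reduceFinMk, Fin.isValue, Fin.reduceEq, ↓reduceIte] at hs hs' ht ht' hu hu' ⊢
      constructor
      · intro h
        rw [← ofAdd_add, ← ofAdd_zero] at h
        have h1 : ((t.val + 1 : ℕ) : ZMod ℓ) + -((t'.val + 1 : ℕ) : ZMod ℓ) = 0 := Multiplicative.ofAdd.injective h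
        refine ⟨Fin.ext (by omega), Fin.ext ?_, Fin.ext (by omega)⟩
        exact hinj _ _ ht ht' (by rwa [← sub_eq_add_neg, sub_eq_zero] at h1)
      · rintro ⟨-, rfl, -⟩
        rw [← ofAdd_add, ← ofAdd_zero, add_neg_cancel]
  · -- local kill from the USP patterns: at a pattern coordinate exactly one of the three terms is a nonzero residue
    have key : ∀ (a b d : Fin 3), (a, b, d) ∈ localStrongUSPPatterns →
        ∀ (s : Fin (if a = 1 then ℓ - 1 else 1)) (t : Fin (if a = 2 then ℓ - 1 else 1))
          (t' : Fin (if b = 2 then ℓ - 1 else 1)) (u : Fin (if b = 0 then ℓ - 1 else 1))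
          (s' : Fin (if d = 1 then ℓ - 1 else 1)) (u' : Fin (if d = 0 then ℓ - 1 else 1)),
          (if a = 1 then Multiplicative.ofAdd (-(((s.val + 1 : ℕ) : ZMod ℓ)))
            else if a = 2 then Multiplicative.ofAdd (((t.val + 1 : ℕ) : ZMod ℓ)) else 1) *
          (if b = 0 then Multiplicative.ofAdd (((u.val + 1 : ℕ) : ZMod ℓ))
            else if b = 2 then Multiplicative.ofAdd (-(((t'.val + 1 : ℕ) : ZMod ℓ))) else 1) ≠
          (if d = 0 then Multiplicative.ofAdd (((u'.val + 1 : ℕ) : ZMod ℓ))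
            else if d = 1 then Multiplicative.ofAdd (-(((s'.val + 1 : ℕ) : ZMod ℓ))) else 1) := by
      intro a b d hp s t t' u s' u'
      have hs := s.isLt; have ht := t.isLt; have ht' := t'.isLt
      have hu := u.isLt; have hs' := s'.isLt; have hu' := u'.isLt
      rw [mem_localStrongUSPPatterns_iff] at hp
      fin_cases a <;> fin_cases b <;> fin_cases d <;>
        simp only [Fin.zero_eta, Fin.mk_one, Fin.reduceFinMk, Fin.isValue, Fin.reduceEq, zero_ne_one, one_ne_zero,
          ne_eq, not_true_eq_false, not_false_eq_true, and_true, and_false, or_false, false_or,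
          or_self, ↓reduceIte] at hp hs ht ht' hu hs' hu' ⊢ <;>
        first
        | (rw [one_mul, ← ofAdd_zero]; exact fun h => hnz _ hu' (Multiplicative.ofAdd.injective h).symm)
        | (rw [one_mul, ← ofAdd_zero]
           exact fun h => hnz _ hs' (neg_eq_zero.mp (Multiplicative.ofAdd.injective h).symm))
        | (rw [one_mul, ← ofAdd_zero]; exact fun h => hnz _ hu (Multiplicative.ofAdd.injective h))
        | (rw [one_mul, ← ofAdd_zero]; exact fun h => hnz _ ht' (neg_eq_zero.mp (Multiplicative.ofAdd.injective h)))
        | (rw [mul_one, ← ofAdd_zero]; exact fun h => hnz _ hs (neg_eq_zero.mp (Multiplicative.ofAdd.injective h)))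
        | (rw [mul_one, ← ofAdd_zero]; exact fun h => hnz _ ht (Multiplicative.ofAdd.injective h))
    intro i j l hne
    obtain ⟨c, hc⟩ := hU i j l hne
    exact ⟨c, fun s t t' u s' u' => key _ _ _ hc s t t' u s' u'⟩
  · -- the value: every word is worth (ℓ-1)^k; the host has ℓ^k elements
    have hvol : ∀ σ : Fin 3, (if σ = 1 then ℓ - 1 else 1) * (if σ = 2 then ℓ - 1 else 1) *
        (if σ = 0 then ℓ - 1 else 1) = ℓ - 1 := by
      intro σ; fin_cases σ <;> simp
    have hword : ∀ i : Fin L, (∏ c, (if row i c = 1 then ℓ - 1 else 1)) * (∏ c, (if row i c = 2 then ℓ - 1 else 1)) *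
        (∏ c, (if row i c = 0 then ℓ - 1 else 1)) = (ℓ - 1) ^ k := by
      intro i
      rw [← Finset.prod_mul_distrib, ← Finset.prod_mul_distrib]
      rw [Finset.prod_congr rfl (fun c _ => hvol (row i c)), Finset.prod_const, Finset.card_univ, Fintype.card_fin]
    have hcard : (Fintype.card (Multiplicative (ZMod ℓ)) : ℝ) = ℓ := by
      rw [Fintype.card_multiplicative, ZMod.card]
    rw [hcard]
    simp only [hword, Finset.sum_const, Finset.card_univ, Fintype.card_fin, nsmul_eq_mul]
    exact hval

/-- **The instance.**  The tree's width-11 local strong USP `cyc11` (11 rows) over `ℤ/17` is a capacity design at exponent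
`21/22`: `17^11 < 11 · (16^11)^{21/22} = 11 · 2^42`. [folklore] -/
theorem capacityBodyAt_cyc11 :
    ∃ (C : Type) (_ : CommMonoid C) (_ : Fintype C),
      (∀ x : C, ∃ y : C, x * y * x = x) ∧
      ∃ (k : ℕ) (ag bg cg : Fin k → ℕ)
        (αg : (Σ σ : Fin k, Fin (ag σ) × Fin (bg σ)) → C)
        (βg : (Σ σ : Fin k, Fin (bg σ) × Fin (cg σ)) → C)
        (γg : (Σ σ : Fin k, Fin (ag σ) × Fin (cg σ)) → C)
        (L n : ℕ) (row : Fin L → Fin n → Fin k),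
        (∀ (σ : Fin k) (s s' : Fin (ag σ)) (t t' : Fin (bg σ)) (u u' : Fin (cg σ)),
            αg ⟨σ, (s, t)⟩ * βg ⟨σ, (t', u)⟩ = γg ⟨σ, (s', u')⟩ ↔ (s' = s ∧ t = t' ∧ u' = u)) ∧
        (∀ i j l : Fin L, (i ≠ j ∨ j ≠ l) → ∃ c : Fin n,
            ∀ (s : Fin (ag (row i c))) (t : Fin (bg (row i c))) (t' : Fin (bg (row j c)))
              (u : Fin (cg (row j c))) (s' : Fin (ag (row l c))) (u' : Fin (cg (row l c))),
              αg ⟨row i c, (s, t)⟩ * βg ⟨row j c, (t', u)⟩ ≠ γg ⟨row l c, (s', u')⟩) ∧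
        (Fintype.card C : ℝ) ^ n <
          ∑ i : Fin L, (((∏ c, ag (row i c)) * (∏ c, bg (row i c)) * (∏ c, cg (row i c)) : ℕ) : ℝ) ^
            ((21 : ℝ) / 22) := by
  refine capacityBodyAt_of_isLocalStrongUSP 17 (by norm_num) 11 11 cyc11 cyc11_isLocalStrongUSP _ ?_
  -- 17^11 < 11 * (16^11)^(21/22) = 11 * 2^42
  have h16 : (((17 - 1) ^ 11 : ℕ) : ℝ) = (2 : ℝ) ^ (44 : ℝ) := by norm_num
  have hpow : ((((17 - 1) ^ 11 : ℕ) : ℝ)) ^ ((21 : ℝ) / 22) = (2 : ℝ) ^ (42 : ℕ) := by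
    rw [h16, ← Real.rpow_mul (by norm_num)]
    norm_num
  rw [hpow]
  norm_num

/-- **The stub's ∃-body holds at `ε = 19/22 < 1`** (genuine kills, `L = 11` words): `(2 + 19/22)/3 = 21/22`.
[folklore] -/
theorem capacityDesignBody_at_nineteen_22nds :
    ∃ (C : Type) (_ : CommMonoid C) (_ : Fintype C),
      (∀ x : C, ∃ y : C, x * y * x = x) ∧
      ∃ (k : ℕ) (ag bg cg : Fin k → ℕ)
        (αg : (Σ σ : Fin k, Fin (ag σ) × Fin (bg σ)) → C)
        (βg : (Σ σ : Fin k, Fin (bg σ) × Fin (cg σ)) → C)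
        (γg : (Σ σ : Fin k, Fin (ag σ) × Fin (cg σ)) → C)
        (L n : ℕ) (row : Fin L → Fin n → Fin k),
        (∀ (σ : Fin k) (s s' : Fin (ag σ)) (t t' : Fin (bg σ)) (u u' : Fin (cg σ)),
            αg ⟨σ, (s, t)⟩ * βg ⟨σ, (t', u)⟩ = γg ⟨σ, (s', u')⟩ ↔ (s' = s ∧ t = t' ∧ u' = u)) ∧
        (∀ i j l : Fin L, (i ≠ j ∨ j ≠ l) → ∃ c : Fin n,
            ∀ (s : Fin (ag (row i c))) (t : Fin (bg (row i c))) (t' : Fin (bg (row j c)))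
              (u : Fin (cg (row j c))) (s' : Fin (ag (row l c))) (u' : Fin (cg (row l c))),
              αg ⟨row i c, (s, t)⟩ * βg ⟨row j c, (t', u)⟩ ≠ γg ⟨row l c, (s', u')⟩) ∧
        (Fintype.card C : ℝ) ^ n <
          ∑ i : Fin L, (((∏ c, ag (row i c)) * (∏ c, bg (row i c)) * (∏ c, cg (row i c)) : ℕ) : ℝ) ^
            ((2 + (19 : ℝ) / 22) / 3) := by
  have h : (2 + (19 : ℝ) / 22) / 3 = (21 : ℝ) / 22 := by norm_num
  rw [h]
  exact capacityBodyAt_cyc11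

end Summit.MatrixMultiplication.MatrixMultiplication.Theorems.SemilatticeSTPPThesis
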